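import Literature.AlgebraicGeometry.Motives.JacobianThetaDivisorOfCurveIso
import HarnessLib

/-!
# Principal Riemann theta divisors exist on one Jacobian model iff on all: reductions of the named fact (F-R)
# `Jacobian.riemann_brillNoetherLocus_isPrincipalPolarizationDivisor`

Layer `Literature/AlgebraicGeometry/Motives`, namespace `Literature.AlgebraicGeometry.Motives.Jacobian`.  KERNEL ONLY:
theorems; no definition, no named fact, no instance, no `sorry`.  Sequel of ★ `Motives/JacobianThetaDivisorOfCurveIso`
(`IsRiemannThetaDivisor.pullback_of_iso`, `IsPrincipalPolarizationDivisor.pullback_of_isIso`).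

The named fact (F-R) ★ `Jacobian.riemann_brillNoetherLocus_isPrincipalPolarizationDivisor` ([Lange2023AbelianVarietiesComplex]
§4.2.1 Lemma 4.2.1 (iii) with Prop. 4.1.2 and Cor. 4.2.4; [Milne1986JacobianVarieties] §6 Thm. 6.6) asserts, for EVERY smooth
projective complex curve `C`, EVERY Jacobian structure `𝒥` of `C` (the tree's Albanese-characterised `Jacobian C`) with
`dim J ≥ 1`, the existence of a Cartier divisor on `J` which is a Riemann theta divisor and a principal polarisation divisor.
Since two Jacobians of one curve are uniquely isomorphic (★ `Jacobian.uniqueUpToIso`, [Milne1986JacobianVarieties] Rem. 6.5) and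
the norm of an isomorphism of curves is an isomorphism of Jacobians transporting both properties (★ brick 2), the witness may be
produced on ANY ONE model — e.g. a complex-analytic model `J = H⁰(ω_C)^*/H₁(C, ℤ)` where theta functions live:

* `exists_isRiemannTheta_isPrincipal_of_iso` — a principal Riemann theta divisor on `J_Y` gives one on `J_X` for `e : X ≅ Y`
  (any field);
* `exists_isRiemannTheta_isPrincipal_iff_of_iso` — the existence is invariant under isomorphisms of curves AND change of
  Jacobian structure;
* **`riemann_brillNoetherLocus_isPrincipalPolarizationDivisor_of_forall_exists_jacobian`** — (F-R) follows from: every smooth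
  projective complex curve has SOME Jacobian structure `𝒥₀` carrying (if `dim J₀ ≥ 1`) a principal Riemann theta divisor.

Use (cell `hodgecm-mathlib`, D-0151; interface row VI-7 (#67), consumer of the d6 `stub_RosH` road): COUNT-NEUTRAL glue for a
future in-tree proof of (F-R) on a convenient model.  HC_CM is proved only modulo the 7 printed citations until rung 0 closes;
this file moves no book by itself.

## References
* [Lange2023AbelianVarietiesComplex] H. Lange, *Abelian Varieties over the Complex Numbers* (2023), §4.1.2 Prop. 4.1.2, §4.2.1
  Lemma 4.2.1 (iii), Cor. 4.2.4.
* [Milne1986JacobianVarieties] J. S. Milne, *Jacobian Varieties*, in Cornell–Silverman (1986), §6 Prop. 6.4, Remark 6.5, Thm. 6.6.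
-/

set_option autoImplicit false

noncomputable section

open CategoryTheory AlgebraicGeometry

universe u

namespace Literature.AlgebraicGeometry.Motives

namespace Jacobian

variable {k : Type u} [Field k] {X Y : SchemeOver k}

/-- **Transport of a principal Riemann theta divisor along an isomorphism of curves**: if `J_Y` (for a Jacobian `𝒥Y` of
`Y`) carries a Cartier divisor which is a Riemann theta divisor and a principal polarisation divisor, so does `J_X` for every
Jacobian `𝒥X` of `X ≅ Y` — namely `(Nm_e)^*Θ` (★ `IsRiemannThetaDivisor.pullback_of_iso`,
★ `IsPrincipalPolarizationDivisor.pullback_of_isIso`; `Nm_e` is an isomorphism, [Milne1986JacobianVarieties] Prop. 6.4).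
[cite: Milne1986JacobianVarieties, §6 Prop. 6.4 and Remark 6.5] [cite: Lange2023AbelianVarietiesComplex, §4.2.1 Cor. 4.2.4 and §4.5.2] -/
theorem exists_isRiemannTheta_isPrincipal_of_iso (𝒥X : Jacobian X) (𝒥Y : Jacobian Y) (e : X ≅ Y)
    (h : ∃ Θ : CartierDivisor 𝒥Y.J.X.left, 𝒥Y.IsRiemannThetaDivisor Θ ∧ 𝒥Y.J.IsPrincipalPolarizationDivisor Θ) :
    ∃ Θ : CartierDivisor 𝒥X.J.X.left, 𝒥X.IsRiemannThetaDivisor Θ ∧ 𝒥X.J.IsPrincipalPolarizationDivisor Θ := by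
  obtain ⟨Θ, h1, h2⟩ := h
  have huv : 𝒥X.pushforward 𝒥Y e.hom ≫ 𝒥Y.pushforward 𝒥X e.inv = 𝟙 _ := by
    rw [← pushforward_comp, e.hom_inv_id, pushforward_id]
  have hvu : 𝒥Y.pushforward 𝒥X e.inv ≫ 𝒥X.pushforward 𝒥Y e.hom = 𝟙 _ := by
    rw [← pushforward_comp, e.inv_hom_id, pushforward_id]
  haveI : IsIso (𝒥X.pushforward 𝒥Y e.hom) := ⟨_, huv, hvu⟩
  haveI : IsDominant (AbelianVariety.Hom.toSchemeHom (𝒥X.pushforward 𝒥Y e.hom)) := by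
    haveI := AbelianVariety.isIso_toSchemeHom_of_isIso (𝒥X.pushforward 𝒥Y e.hom)
    infer_instance
  exact ⟨Θ.pullback (AbelianVariety.Hom.toSchemeHom (𝒥X.pushforward 𝒥Y e.hom)),
    IsRiemannThetaDivisor.pullback_of_iso 𝒥X 𝒥Y e h1,
    AbelianVariety.IsPrincipalPolarizationDivisor.pullback_of_isIso _ h2⟩

/-- The dimensions of the Jacobians of isomorphic curves agree (`Nm_e` is an isomorphism, hence an isogeny).
[cite: Milne1986JacobianVarieties, §6 Prop. 6.4 and Remark 6.5] -/
theorem dim_eq_of_iso (𝒥X : Jacobian X) (𝒥Y : Jacobian Y) (e : X ≅ Y) : 𝒥X.J.dim = 𝒥Y.J.dim := by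
  have huv : 𝒥X.pushforward 𝒥Y e.hom ≫ 𝒥Y.pushforward 𝒥X e.inv = 𝟙 _ := by
    rw [← pushforward_comp, e.hom_inv_id, pushforward_id]
  have hvu : 𝒥Y.pushforward 𝒥X e.inv ≫ 𝒥X.pushforward 𝒥Y e.hom = 𝟙 _ := by
    rw [← pushforward_comp, e.inv_hom_id, pushforward_id]
  haveI : IsIso (𝒥X.pushforward 𝒥Y e.hom) := ⟨_, huv, hvu⟩
  haveI := AbelianVariety.isIso_toSchemeHom_of_isIso (𝒥X.pushforward 𝒥Y e.hom)
  exact AbelianVariety.dim_eq_of_isIsogeny (f := 𝒥X.pushforward 𝒥Y e.hom) ⟨inferInstance, inferInstance⟩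

/-- **The existence of a principal Riemann theta divisor is invariant under isomorphisms of curves and change of Jacobian
structure.** [cite: Milne1986JacobianVarieties, §6 Prop. 6.4 and Remark 6.5] [cite: Lange2023AbelianVarietiesComplex, §4.2.1 Cor. 4.2.4 and §4.5.2] -/
theorem exists_isRiemannTheta_isPrincipal_iff_of_iso (𝒥X : Jacobian X) (𝒥Y : Jacobian Y) (e : X ≅ Y) :
    (∃ Θ : CartierDivisor 𝒥X.J.X.left, 𝒥X.IsRiemannThetaDivisor Θ ∧ 𝒥X.J.IsPrincipalPolarizationDivisor Θ) ↔
      ∃ Θ : CartierDivisor 𝒥Y.J.X.left, 𝒥Y.IsRiemannThetaDivisor Θ ∧ 𝒥Y.J.IsPrincipalPolarizationDivisor Θ :=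
  ⟨exists_isRiemannTheta_isPrincipal_of_iso 𝒥Y 𝒥X e.symm, exists_isRiemannTheta_isPrincipal_of_iso 𝒥X 𝒥Y e⟩

/-- **(F-R) from one Jacobian model per curve.**  If every smooth projective complex curve `C` admits SOME Jacobian structure
`𝒥₀` which, when `dim J₀ ≥ 1`, carries a Cartier divisor that is a Riemann theta divisor and a principal polarisation divisor,
then the named fact ★ `riemann_brillNoetherLocus_isPrincipalPolarizationDivisor` holds (for EVERY Jacobian structure):
transport along `uniqueUpToIso 𝒥₀ 𝒥 = Nm_{𝟙_C}` ([Milne1986JacobianVarieties] Rem. 6.5, Thm. 6.6; [Lange2023AbelianVarietiesComplex]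
Lemma 4.2.1 (iii)).  (The converse is immediate from ★ `nonempty_jacobian_of_isSmoothProjective_complex`, not imported here to
keep the cone light.) [cite: Milne1986JacobianVarieties, §6 Remark 6.5 and Thm. 6.6] [cite: Lange2023AbelianVarietiesComplex, §4.2.1 Lemma 4.2.1 (iii) and Cor. 4.2.4] -/
theorem riemann_brillNoetherLocus_isPrincipalPolarizationDivisor_of_forall_exists_jacobian
    (h : ∀ (C : SchemeOver ℂ), IsSmoothProjective 1 C → ∃ 𝒥₀ : Jacobian C, (1 ≤ 𝒥₀.J.dim →
      ∃ Θ : CartierDivisor 𝒥₀.J.X.left, 𝒥₀.IsRiemannThetaDivisor Θ ∧ 𝒥₀.J.IsPrincipalPolarizationDivisor Θ)) :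
    riemann_brillNoetherLocus_isPrincipalPolarizationDivisor := by
  intro C hC 𝒥 hdim
  obtain ⟨𝒥₀, h0⟩ := h C hC
  have hdim0 : 1 ≤ 𝒥₀.J.dim := by rw [dim_eq_of_iso 𝒥₀ 𝒥 (Iso.refl C)]; exact hdim
  exact exists_isRiemannTheta_isPrincipal_of_iso 𝒥 𝒥₀ (Iso.refl C) (h0 hdim0)

end Jacobian

end Literature.AlgebraicGeometry.Motives

end
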